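import Summits.QuantumFields.YangMills.Theorems.FemtoCutoffLadderThinning
import Literature.MathematicalPhysics.QuantumFieldTheory.TorusConfigShift
import HarnessLib

/-!
# Route `FlatTubeReduction` — DEFINITIONS: fine supports of thinned parts, contractible slices and the arc potential
# (kinematics of the W-inj(m=1) proof for crux `PinnedUnitStepEx`, stmt-QuantumFields-27561, stub `stub_smearVarPosGS1`)

Seat ym-line-fcl-p3 g9 (2026-08-28).  Blueprint `WINJ-lean-blueprint-fcl-p3-g9.md` (evidence on the item), file D0.  Convention «B′»: the tree's
thinning `Thinning.thin L'` read through the fine translation `τ_v` (`torusConfigShift v`) IS the decimation with decoder `v`; at `L = L'+1` it doubles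
exactly the coarse links issuing from coordinate `0` of their own direction.  Objects posited by the proof (route-posited kinematics, no literature):
* `pathLinks L v e'` — the fine links whose ordered product is `(thin L' (τ_v U)) e'` (`thin_apply`, `torusConfigShift_apply`): the `thinSteps` links of
  direction `e'.2` from `thinSite e'.1 − v`;
* `fineSupp L v R = ⋃_{e' ∈ R} pathLinks L v e'` — the exact fine support of a part `g^{=R} ∘ thin L' ∘ τ_v`;
* `IsContr j c R` — slice `{x_j = c}` of a link set `R` on `(ℤ/M)³` is CONTRACTIBLE: it carries no link of `R` of direction `≠ j`, and at each of its sites the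
  `j`-link of `R` coming in is present iff the one going out is; `contrSlices j R` the set of such `c`;
* `arcs C` — for `C ⊆ ℤ/M`, the number of pairs `(c, d)`, `d < M`, with `c, c+1, …, c+d ∈ C` (all-`C` cyclic windows; `= Σ_runs ℓ(ℓ+1)/2` when `C ≠ ℤ/M`);
  `pot R = Σ_j arcs (contrSlices j R)` — the translation-invariant ℕ-valued potential of the extremal argument (memo §P4–P5).
Definitions only (classical decidability inside the `Finset.filter`s; no instances, no notation); nothing here proves any stub, crux or summit.
-/

set_option autoImplicit false

noncomputable section

namespace Summit.QuantumFields.YangMills.Theorems.FlatTubeReduction.Decimation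

open Literature.MathematicalPhysics.QuantumFieldTheory (Site Edge GaugeConfig)
open Summit.QuantumFields.YangMills.Theorems.FemtoCutoffLadder.Thinning (thinSite thinSteps)

/-- The fine links entering the coarse link `e'` under thinning read through the translation `v`: the `thinSteps L L' (e'.1 e'.2)` consecutive
links of direction `e'.2` starting at the fine site `thinSite L e'.1 − v`.  Their ordered product is `(thin L' (torusConfigShift v U)) e'`. [folklore] -/
def pathLinks (L : ℕ) {L' : ℕ} (v : Site 3 L) (e' : Edge 3 L') : Finset (Edge 3 L) :=
  (Finset.range (thinSteps L L' (e'.1 e'.2))).image fun s =>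
    (thinSite L e'.1 + Pi.single e'.2 ((s : ℕ) : ZMod L) - v, e'.2)

/-- The fine support of a set `R` of coarse links under the decoder `v`: the union of the path links. [folklore] -/
def fineSupp (L : ℕ) {L' : ℕ} (v : Site 3 L) (R : Finset (Edge 3 L')) : Finset (Edge 3 L) :=
  R.biUnion (pathLinks L v)

/-- Slice `{x_j = c}` of a link set `R ⊆ Edge 3 M` is **contractible**: (i) no link of `R` of a direction other than `j` issues from a site of the slice,
(ii) at every site `y` of the slice, the incoming `j`-link `(y − e_j, j)` belongs to `R` iff the outgoing one `(y, j)` does.  (Contracting such a slice —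
multiplying each incoming/outgoing pair — yields a link set on the torus with one slice less; these are exactly the slices a decoder may delete.)
A route-posited combinatorial PREDICATE of the W-inj proof, NOT a literature fact. -/
def IsContr {M : ℕ} (j : Fin 3) (c : ZMod M) (R : Finset (Edge 3 M)) : Prop :=
  (∀ e ∈ R, e.1 j = c → e.2 = j) ∧ ∀ y : Site 3 M, y j = c → ((y - Pi.single j 1, j) ∈ R ↔ (y, j) ∈ R)

open Classical in
/-- The set of contractible `j`-slices of `R`. [folklore] -/
def contrSlices {M : ℕ} [NeZero M] (j : Fin 3) (R : Finset (Edge 3 M)) : Finset (ZMod M) :=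
  Finset.univ.filter fun c => IsContr j c R

open Classical in
/-- **Arc count** of `C ⊆ ℤ/M`: the number of pairs `(c, d)` with `d < M` and `c, c+1, …, c+d ∈ C`.  For `C ≠ ℤ/M` this is `Σ_runs ℓ(ℓ+1)/2` over the
maximal cyclic runs of `C`; deleting one element of a run of length `ℓ` lowers it by exactly `ℓ`. [folklore] -/
def arcs {M : ℕ} [NeZero M] (C : Finset (ZMod M)) : ℕ :=
  (((Finset.univ : Finset (ZMod M)) ×ˢ Finset.range M).filter fun p => ∀ i : ℕ, i ≤ p.2 → p.1 + (i : ZMod M) ∈ C).card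

/-- **The potential** of a coarse link set: total arc count of its contractible slices over the three directions (invariant under translations of
`R`; the extremal part of the W-inj proof maximises it over the support of the Hoeffding decomposition). [folklore] -/
def pot {M : ℕ} [NeZero M] (R : Finset (Edge 3 M)) : ℕ :=
  ∑ j : Fin 3, arcs (contrSlices j R)

end Summit.QuantumFields.YangMills.Theorems.FlatTubeReduction.Decimation
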